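import Literature.NumberTheory.Automorphic.QuadraticBaseChangeFrobCompatibleAuxFieldProofs
import HarnessLib

/-!
# Frobenius compatibility of quadratic base change at the places over ramified primes, IV:
# the auxiliary field split at `w`, and the assembly from Carayol's theorem ALONE

Topic `Literature/NumberTheory/Automorphic`; fifth *proofs* file (theorems only — no definition,
no named fact) of the seat of `Langlands1980_quadraticBaseChange_frobCompatible`
(`QuadraticBaseChangeFrobCompatible`), continuing `…Proofs`, `…CarayolProofs`,
`…NonSelfTwistProofs`, `…AuxFieldProofs` and `GaloisRepresentations/InertiaTwoQuadraticFields`.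

The previous file assembled the fact from FIVE inputs: Carayol's ramification clause (C) (an inline
hypothesis), lang.S27 (`exists_galoisRep_of_regularAlgebraic` — over the quadratic `F`, i.e.
Harris–Lan–Taylor–Thorne / Scholze when `F` is imaginary), and three clauses of Langlands' base
change (`ArthurClozel1989_strongLifting_archimedean`, `…_unramified`, `baseChange_cyclic_cuspidal`).
lang.S27 entered at two points only: (a) to upgrade the almost-everywhere compatibility of `ρ` to
compatibility at EVERY unramified place off `p` (the hypothesis of (C)), over `ℚ` and over the
auxiliary real quadratic `F₁`; (b) in the very last step, over `F` itself, to read the Frobenius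
polynomial of `ρ|_{Γ_F}` at `w` once `P` is known to be unramified there.

This file removes lang.S27 altogether — so that the fact rests on Carayol's theorem and
Langlands' base change only, exactly the sources it cites — by two changes.

**(a) Carayol's theorem in its natural a.e. form (C').**  Théorème (A) of Carayol 1986 is the
compatibility `σ_λ|_{W_𝔭} ≃ σ_λ(π_𝔭)` at EVERY finite `𝔭 ∤ λ`; a continuous irreducible `r`
compatible with `π` at almost every place is `≃ σ_λ` (Chebotarev and Brauer–Nesbitt: `r ≃ σ_λ^{ss}`,
and `σ_λ^{ss} ≃ r` irreducible forces `σ_λ` irreducible), so (A) with Kutzko's unramified dictionary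
(§0.5) gives, at every `w ∤ ℓ`: `r` is compatible with `π` at `w` (`IsGaloisCompatibleAt`, the
clause of lang.S27) AND `r` unramified at `w` ⇒ `π` unramified at `w`.  This is the inline
hypothesis `hCar` below ((C') of the seat notes; for `[K:ℚ]` even, at the places where `π` has no
discrete series: Taylor 1989/1990, as recorded by Jarvis 1997, p. 18, "Taylor ([13] and [14]) shows
that Theorem 6.1 suffices to determine exactly the restriction … in the cases (P1)–(P3), and that
this restriction is then equivalent to `σ^λ(π_𝔭)`"; the whole statement is (1) of Skinner 2009 §1,
"established by Carayol, Wiles, Blasius and Rogawski, and Taylor").  With (C') the upgrade (a)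
is part of the hypothesis' conclusion.

**(b) The auxiliary field SPLIT at `w`.**  In Case B (`ℓ = w ∩ ℤ` ramified in `F = ℚ(√c)`), the
auxiliary `m = ±q` is now taken `≡ 1 (mod 8ℓ)`, so that `√m ∈ ℚ_ℓ`: then `w` splits in
`M = F(√m)` and the place `u` of `F₁ = ℚ(√(cm))` above `ℓ` splits in `M` (Galois form: an element
of `Γ_K` mapping a prime `𝔓 ∣ ℓ` into itself fixes `√m`, `smul_eq_self_of_smul_mem_of_sq_eq`, for
`(1 ± √m)/2 ∈ 𝔓`; hence a Frobenius at `𝔓` lies in `res(Γ_M)` and `f = 1`,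
`inertiaDegIn_eq_one_of_sq_eq_intCast`).  Consequently the Satake parameter of
`𝒫 = BC_{M/F}(P) = BC_{M/F₁}(P₁)` at a place `ω ∣ w` is BOTH `t_{P,w}^{f(ω|w)} = t_{P,w}` and
`t_{P₁,u}^{f(ω|u)} = t_{P₁,u}` (Arthur–Clozel (1.1) at unramified places), so `t_{P,w} = t_{P₁,u}`;
and the Frobenius polynomial of `ρ|_{Γ_{F₁}}` at `u` — known by (C') over the totally real `F₁` —
IS the Frobenius polynomial of `ρ|_{Γ_F}` at `w`, the decomposition groups above `ℓ` of `Γ_ℚ`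
meeting `res(Γ_F)` and `res(Γ_{F₁})` in the same subgroup
(`FramedGaloisRep.hasFrobCharpolyAt_restrictField_of_smul_mem_of_mem_range`).  No Galois
representation attached to `P` is ever needed.

Contents: §1 Galois lemmas (decomposition elements fix `√m`; splitting of `K(√m)`; transfer of
Frobenius polynomials between `F` and `F₁`); §2 the half-twist bookkeeping almost everywhere
(no lang.S27); §3 Case A and the real-quadratic step from (C'); §4 Case B with the auxiliary fields
abstract (`…_at_of_auxField'`); §5 Case B concrete and the assembly
`Langlands1980_quadraticBaseChange_frobCompatible_of_carayol'
  (hCar : (C')) (hArch) (hBCc) (hACu) : Langlands1980_quadraticBaseChange_frobCompatible`.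

## References

* R. P. Langlands, *Base change for GL(2)*, Ann. of Math. Stud. 96 (1980), §2 (A), (F), (i).
  [LanglandsBaseChange1980]
* H. Carayol, *Sur les représentations ℓ-adiques associées aux formes modulaires de Hilbert*,
  Ann. Sci. ÉNS 19 (1986), §0.3, §0.5, Thm. (A) (pp. 410–411). [CarayolASENS1986]
* R. Taylor, *On Galois representations associated to Hilbert modular forms*, Invent. Math. 98
  (1989) 265–280. [TaylorInventMath1989]
* F. Jarvis, *On Galois representations associated to Hilbert modular forms*, J. reine angew.
  Math. 491 (1997), §7 (p. 18). [Jarvis1997]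
* C. Skinner, *A note on the p-adic Galois representations attached to Hilbert modular forms*,
  Doc. Math. 14 (2009), §1 (1). [Skinner2009]
* J. Arthur, L. Clozel, *Simple algebras, base change, and the advanced theory of the trace
  formula*, Ann. of Math. Stud. 120 (1989), Ch. 3 Thm. 4.2, Thm. 5.1, §1 (1.1). [ArthurClozelAMS120]
* J. Neukirch, *Algebraic Number Theory* (1999), Ch. I §8–§9. [NeukirchANT1999]
* D. A. Marcus, *Number Fields* (2018), Ch. 4, Thm. 29. [Marcus2018]
-/

noncomputable section

open scoped MatrixGroups Matrix NumberField Polynomial Classical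
open NumberField IsDedekindDomain Field Polynomial Filter

/-! ## §1 Galois lemmas -/

namespace Literature.NumberTheory.GaloisRepresentations

section SquareRoot

variable {K : Type*} [Field K] [NumberField K]

/-- **An element of `Γ_K` mapping a prime `𝔓` into itself fixes `√m` when `𝔓 ∣ (m-1)/4`.**  Let
`𝔓` be a prime of `\bar ℤ_K`, `s ∈ K̄` with `s² = m = 4k+1` and `k ∈ 𝔓`, and `g ∈ Γ_K` with
`g 𝔓 ⊆ 𝔓` (e.g. `g` in the decomposition group, or an arithmetic Frobenius at `𝔓`).  Then
`g s = s`: `t = (1+s)/2` is an algebraic integer with `t(t-1) = k ∈ 𝔓`, so `t ∈ 𝔓` or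
`t - 1 ∈ 𝔓`; and `g s = -s` means `g t = 1 - t`, which in either case puts `1` in `𝔓`.  (This is
the splitting above `𝔓` of `K(√m)/K` when `√m ∈ K_𝔓`, in the form needed below; companion of
`smul_eq_self_of_mem_inertia_of_sq_eq`.)  Neukirch I §8; Marcus Ch. 4, Thm. 29.
[cite: NeukirchANT1999, Ch. I §8] -/
theorem smul_eq_self_of_smul_mem_of_sq_eq {𝔓 : Ideal (absIntegers (𝓞 K) K)} [𝔓.IsPrime]
    {s : AlgebraicClosure K} {m k : ℤ} (hmk : m = 4 * k + 1)
    (hs : s ^ 2 = (m : AlgebraicClosure K)) (hk : ((k : absIntegers (𝓞 K) K)) ∈ 𝔓)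
    {g : absoluteGaloisGroup K} (hg : ∀ x ∈ 𝔓, g • x ∈ 𝔓) : g • s = s := by
  -- `s` and `t = (1+s)/2` are algebraic integers, `t (t - 1) = k`
  have hsZ : IsIntegral ℤ s := by
    refine ⟨X ^ 2 - C m, monic_X_pow_sub_C _ two_ne_zero, ?_⟩
    rw [eval₂_sub, eval₂_X_pow, eval₂_C, eq_intCast, hs, sub_self]
  set t : AlgebraicClosure K := (1 + s) / 2 with ht
  have hm' : ((4 * k + 1 : ℤ) : AlgebraicClosure K) = (m : AlgebraicClosure K) := by rw [hmk]
  have htt : t * (t - 1) = (k : AlgebraicClosure K) := by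
    have key : t * (t - 1) - (k : AlgebraicClosure K) =
        (s ^ 2 - ((4 * k + 1 : ℤ) : AlgebraicClosure K)) / 4 := by
      rw [ht]; push_cast; ring
    rw [← sub_eq_zero, key, hm', hs, sub_self, zero_div]
  have htZ : IsIntegral ℤ t := by
    refine ⟨X ^ 2 - X - C k, ?_, ?_⟩
    · have h : (X ^ 2 - X - C k : ℤ[X]) = X ^ 2 - (X + C k) := by ring
      rw [h]
      exact monic_X_pow_sub (by compute_degree!)
    · rw [eval₂_sub, eval₂_sub, eval₂_X_pow, eval₂_X, eval₂_C, eq_intCast]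
      have : t ^ 2 - t - (k : AlgebraicClosure K) = t * (t - 1) - k := by ring
      rw [this, htt, sub_self]
  have hsI : s ∈ absIntegers (𝓞 K) K := by
    rw [mem_integralClosure_iff]; exact hsZ.tower_top
  have htI : t ∈ absIntegers (𝓞 K) K := by
    rw [mem_integralClosure_iff]; exact htZ.tower_top
  -- `t ∈ 𝔓` or `t - 1 ∈ 𝔓`
  have hprod : (⟨t, htI⟩ : absIntegers (𝓞 K) K) * (⟨t, htI⟩ - 1) = (k : absIntegers (𝓞 K) K) := by
    apply Subtype.ext
    change t * (t - 1) = ((k : absIntegers (𝓞 K) K) : AlgebraicClosure K)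
    rw [htt]
    rfl
  have hmem : (⟨t, htI⟩ : absIntegers (𝓞 K) K) ∈ 𝔓 ∨ (⟨t, htI⟩ : absIntegers (𝓞 K) K) - 1 ∈ 𝔓 :=
    Ideal.IsPrime.mem_or_mem ‹𝔓.IsPrime› (by rw [hprod]; exact hk)
  -- `g s = ± s`
  have hgs2 : (g • s) ^ 2 = (m : AlgebraicClosure K) := by
    rw [absoluteGaloisGroup.smul_def, ← map_pow, hs, map_intCast]
  have hpm : g • s = s ∨ g • s = -s := by
    have h0 : (g • s - s) * (g • s + s) = 0 := by
      have : (g • s) ^ 2 - s ^ 2 = 0 := by rw [hgs2, hs, sub_self]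
      linear_combination this
    rcases mul_eq_zero.mp h0 with h | h
    · exact Or.inl (sub_eq_zero.mp h)
    · exact Or.inr (eq_neg_of_add_eq_zero_left h)
  rcases hpm with h | h
  · exact h
  · -- `g s = -s`: then `g t = 1 - t`, and `1 ∈ 𝔓`
    exfalso
    have hgt : g • (⟨t, htI⟩ : absIntegers (𝓞 K) K) = 1 - ⟨t, htI⟩ := by
      apply Subtype.ext
      rw [integralClosure.coe_smul]
      change g • t = ((1 - ⟨t, htI⟩ : absIntegers (𝓞 K) K) : AlgebraicClosure K)
      rw [AddSubgroupClass.coe_sub, OneMemClass.coe_one]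
      change g • t = 1 - t
      rw [ht, absoluteGaloisGroup.smul_def, map_div₀, map_add, map_one, map_ofNat,
        ← absoluteGaloisGroup.smul_def, h]
      ring
    apply Ideal.IsPrime.ne_top ‹𝔓.IsPrime›
    rw [Ideal.eq_top_iff_one]
    rcases hmem with h1 | h1
    · have h2 := hg _ h1
      rw [hgt] at h2
      have := 𝔓.add_mem h2 h1
      rwa [sub_add_cancel] at this
    · have h2 := hg _ h1
      rw [smul_sub, smul_one, hgt, sub_sub_cancel_left] at h2
      rw [neg_mem_iff] at h2
      have := 𝔓.sub_mem h2 h1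
      rwa [sub_sub_cancel] at this

/-- An arithmetic Frobenius at `𝔓` maps `𝔓` into itself (`Φ x ≡ x^q (mod 𝔓)` and `x^q ∈ 𝔓` for
`x ∈ 𝔓`). [folklore] -/
theorem smul_mem_of_isArithFrobAt {v : HeightOneSpectrum (𝓞 K)} {𝔓 : Ideal (absIntegers (𝓞 K) K)}
    (h𝔓 : 𝔓 ∈ v.primesAbove) {Φ : absoluteGaloisGroup K} (hΦ : IsArithFrobAt (𝓞 K) Φ 𝔓)
    {x : absIntegers (𝓞 K) K} (hx : x ∈ 𝔓) : Φ • x ∈ 𝔓 := by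
  have h1 := (HeightOneSpectrum.isArithFrobAt_iff_of_mem_primesAbove h𝔓 Φ).mp hΦ x
  have h2 : x ^ v.residueCard ∈ 𝔓 :=
    𝔓.pow_mem_of_mem hx _ (Nat.zero_lt_of_lt v.one_lt_residueCard)
  have := 𝔓.add_mem h1 h2
  rwa [sub_add_cancel] at this

/-- **`K(√m)/K` splits at the places dividing `(m-1)/4`** (`m ≡ 1 (mod 4)`): if `M/K` is
quadratic, generated by `μ` with `μ² = m = 4k+1`, and `k` lies in every prime of `\bar ℤ_K` above
the place `v`, then all places of `M` above `v` have residue degree `f = 1`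
(`inertiaDegIn v (𝓞 M) = 1`).  A Frobenius `Φ` at a prime `𝔓 ∣ v` maps `𝔓` into itself, hence
fixes `e(μ)` (`smul_eq_self_of_smul_mem_of_sq_eq`), i.e. lies in `res(Γ_M)`
(`mem_range_absGaloisRestrict_iff_smul_gen_eq`); a Frobenius in `res(Γ_M)` forces `f = 1` at the
place below `ι 𝔓` (`inertiaDeg_eq_one_of_isArithFrobAt_absGaloisRestrict`, Marcus Thm. 29), and
`M/K` being Galois all `f` above `v` agree. [cite: Marcus2018, Ch. 4, Thm. 29] -/
theorem inertiaDegIn_eq_one_of_sq_eq_intCast (M : Type*) [Field M] [NumberField M] [Algebra K M]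
    (h2 : Module.finrank K M = 2) {μ : M} (hμK : μ ∉ Set.range (algebraMap K M)) {m k : ℤ}
    (hmk : m = 4 * k + 1) (hμ : μ ^ 2 = (m : M)) (v : HeightOneSpectrum (𝓞 K))
    (hk : ∀ 𝔓 ∈ v.primesAbove, ((k : absIntegers (𝓞 K) K)) ∈ 𝔓) :
    v.asIdeal.inertiaDegIn (𝓞 M) = 1 := by
  haveI : FiniteDimensional K M := Module.finite_of_finrank_pos (by rw [h2]; exact two_pos)
  haveI : Algebra.IsQuadraticExtension K M := ⟨h2⟩
  haveI : IsGalois K M := inferInstance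
  haveI : Algebra.IsAlgebraic K M := Algebra.IsAlgebraic.of_finite K M
  set e := absEmbedding K M with hedef
  have he := mem_range_absGaloisRestrict_iff_smul_absEmbedding K M
  obtain ⟨𝔓, h𝔓⟩ := v.primesAbove_nonempty
  haveI : 𝔓.IsPrime := h𝔓.1
  obtain ⟨Φ, hΦ⟩ := HeightOneSpectrum.exists_isArithFrobAt_of_mem_primesAbove_holds h𝔓
  have ht : (e μ) ^ 2 = (m : AlgebraicClosure K) := by rw [← map_pow, hμ, map_intCast]
  have hfix : Φ • e μ = e μ :=
    smul_eq_self_of_smul_mem_of_sq_eq hmk ht (hk 𝔓 h𝔓) (fun x hx ↦ smul_mem_of_isArithFrobAt h𝔓 hΦ hx)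
  obtain ⟨τ, hτ⟩ : Φ ∈ (absGaloisRestrict K M).range :=
    (mem_range_absGaloisRestrict_iff_smul_gen_eq h2 hμK he Φ).mpr hfix
  replace hτ : absGaloisRestrict K M τ = Φ := hτ
  obtain ⟨𝔔, h𝔔prime, h𝔔⟩ := exists_isPrime_comap_absIntegersMap_eq K M 𝔓
  haveI := h𝔔prime
  obtain ⟨w, hw, h𝔔w, -⟩ :=
    exists_heightOneSpectrum_of_comap_absIntegersMap_mem_primesAbove (K := K) (M := M) (𝔔 := 𝔔)
      (h𝔔.symm ▸ h𝔓)
  have hΦ' : IsArithFrobAt (𝓞 K) (absGaloisRestrict K M τ) (𝔔.comap (absIntegersMap K M)) := by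
    rw [hτ, h𝔔]; exact hΦ
  have hf : w.asIdeal.inertiaDeg (𝓞 K) = 1 :=
    inertiaDeg_eq_one_of_isArithFrobAt_absGaloisRestrict hw h𝔔w hΦ'
  rw [← inertiaDeg_eq_inertiaDegIn hw]
  exact hf

end SquareRoot

section Transfer

variable {K : Type*} [Field K] [NumberField K] {F : Type*} [Field F] [NumberField F] [Algebra K F]
  {F₁ : Type*} [Field F₁] [NumberField F₁] [Algebra K F₁]
  {A : Type*} [CommRing A] [TopologicalSpace A] {n : ℕ}

/-- **A place of residue degree one of `F` above `v` whose decomposition groups pass to `F₁` forces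
residue degree one above `v` in the Galois `F₁`.**  Suppose that for every prime `𝔓 ∣ v` of
`\bar ℤ_K`, every `g ∈ res(Γ_F)` mapping `𝔓` into itself lies in `res₁(Γ_{F₁})`, and that `F` has a
place `w ∣ v` with `f(w|v) = 1`.  A Frobenius `γ ∈ Γ_F` at a prime `𝔔 ∣ w` restricts to a Frobenius
`Φ = res γ` of `K` at `ι⁻¹𝔔` (`q_w = q_v`), which lies in `res₁(Γ_{F₁})`; so the place of `F₁` below
`ι₁(ι⁻¹𝔔)` has `f = 1` (`inertiaDeg_eq_one_of_isArithFrobAt_absGaloisRestrict`), hence all places of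
`F₁` above `v`. [cite: Marcus2018, Ch. 4, Thm. 29] [cite: NeukirchANT1999, Ch. I §9 (9.4)–(9.5)] -/
theorem inertiaDegIn_eq_one_of_smul_mem_of_mem_range [IsGalois K F₁] {v : HeightOneSpectrum (𝓞 K)}
    (hD : ∀ 𝔓 ∈ v.primesAbove, ∀ g : absoluteGaloisGroup K, (∀ x ∈ 𝔓, g • x ∈ 𝔓) →
      g ∈ (absGaloisRestrict K F).range → g ∈ (absGaloisRestrict K F₁).range)
    {w : HeightOneSpectrum (𝓞 F)} (hw : w.asIdeal.under (𝓞 K) = v.asIdeal)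
    (hfw : w.asIdeal.inertiaDeg (𝓞 K) = 1) : v.asIdeal.inertiaDegIn (𝓞 F₁) = 1 := by
  haveI : Algebra.IsAlgebraic K F := Algebra.IsAlgebraic.tower_top (K := ℚ) K
  haveI : Algebra.IsAlgebraic K F₁ := Algebra.IsAlgebraic.tower_top (K := ℚ) K
  obtain ⟨𝔔, h𝔔⟩ := w.primesAbove_nonempty
  haveI : 𝔔.IsPrime := h𝔔.1
  obtain ⟨γ, hγ⟩ := HeightOneSpectrum.exists_isArithFrobAt_of_mem_primesAbove_holds h𝔔
  have h𝔓 : 𝔔.comap (absIntegersMap K F) ∈ v.primesAbove := comap_absIntegersMap_mem_primesAbove hw h𝔔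
  have hΦ : IsArithFrobAt (𝓞 K) (absGaloisRestrict K F γ) (𝔔.comap (absIntegersMap K F)) :=
    isArithFrobAt_absGaloisRestrict_of_inertiaDeg_eq_one hw h𝔔 hγ hfw
  obtain ⟨δ, hδ⟩ : absGaloisRestrict K F γ ∈ (absGaloisRestrict K F₁).range :=
    hD _ h𝔓 _ (fun x hx ↦ smul_mem_of_isArithFrobAt h𝔓 hΦ hx) ⟨γ, rfl⟩
  replace hδ : absGaloisRestrict K F₁ δ = absGaloisRestrict K F γ := hδ
  haveI : (𝔔.comap (absIntegersMap K F)).IsPrime := h𝔓.1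
  obtain ⟨𝔔₁, h𝔔₁prime, h𝔔₁⟩ :=
    exists_isPrime_comap_absIntegersMap_eq K F₁ (𝔔.comap (absIntegersMap K F))
  haveI := h𝔔₁prime
  obtain ⟨u, hu, h𝔔₁u, -⟩ :=
    exists_heightOneSpectrum_of_comap_absIntegersMap_mem_primesAbove (K := K) (M := F₁) (𝔔 := 𝔔₁)
      (h𝔔₁.symm ▸ h𝔓)
  have hΦ₁ : IsArithFrobAt (𝓞 K) (absGaloisRestrict K F₁ δ) (𝔔₁.comap (absIntegersMap K F₁)) := by
    rw [hδ, h𝔔₁]; exact hΦ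
  have hfu : u.asIdeal.inertiaDeg (𝓞 K) = 1 :=
    inertiaDeg_eq_one_of_isArithFrobAt_absGaloisRestrict hu h𝔔₁u hΦ₁
  rw [← inertiaDeg_eq_inertiaDegIn hu]
  exact hfu

/-- **Transfer of Frobenius characteristic polynomials between two extensions sharing their
decomposition groups above `v`.**  Let `σ : Γ_K → GL_n(A)`, `v` a finite place of `K`, and
suppose that for every prime `𝔓 ∣ v` of `\bar ℤ_K`, every element of `res(Γ_F)` mapping `𝔓` into
itself lies in `res₁(Γ_{F₁})` (e.g. `D_𝔓 ∩ res(Γ_F) = D_𝔓 ∩ res₁(Γ_{F₁})`).  Let `w ∣ v` be a place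
of `F` with `f(w|v) = 1` and suppose `σ|_{Γ_{F₁}}` has arithmetic-Frobenius characteristic
polynomial `P` at every place of `F₁` above `v`.  Then `σ|_{Γ_F}` has arithmetic-Frobenius
characteristic polynomial `P` at `w`: a Frobenius `γ` at `𝔔 ∣ w` gives the Frobenius `Φ = res γ` of
`K` at `𝔓 = ι⁻¹𝔔` (`q_w = q_v`), `Φ = res₁ δ` with `δ ∈ Γ_{F₁}`; the place `u` of `F₁` below `ι₁ 𝔓`
then has `f(u|v) = 1` (`inertiaDeg_eq_one_of_isArithFrobAt_absGaloisRestrict`), so `δ` is a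
Frobenius of `F₁` at `ι₁ 𝔓 ∣ u` (`isArithFrobAt_of_absGaloisRestrict_eq_pow`), and
`σ(res γ) = σ(res₁ δ)` has characteristic polynomial `P`.  Neukirch I §9 (9.4)–(9.5); Marcus Ch. 4
Thm. 29. [cite: NeukirchANT1999, Ch. I §9 (9.4)–(9.5)] -/
theorem FramedGaloisRep.hasFrobCharpolyAt_restrictField_of_smul_mem_of_mem_range
    (σ : FramedGaloisRep K A n) {v : HeightOneSpectrum (𝓞 K)}
    (hD : ∀ 𝔓 ∈ v.primesAbove, ∀ g : absoluteGaloisGroup K, (∀ x ∈ 𝔓, g • x ∈ 𝔓) →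
      g ∈ (absGaloisRestrict K F).range → g ∈ (absGaloisRestrict K F₁).range)
    {w : HeightOneSpectrum (𝓞 F)} (hw : w.asIdeal.under (𝓞 K) = v.asIdeal)
    (hfw : w.asIdeal.inertiaDeg (𝓞 K) = 1) {P : Polynomial A}
    (h₁ : ∀ u : HeightOneSpectrum (𝓞 F₁), u.asIdeal.under (𝓞 K) = v.asIdeal →
      (σ.restrictField F₁).HasFrobCharpolyAt u P) :
    (σ.restrictField F).HasFrobCharpolyAt w P := by
  haveI : Algebra.IsAlgebraic K F := Algebra.IsAlgebraic.tower_top (K := ℚ) K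
  haveI : Algebra.IsAlgebraic K F₁ := Algebra.IsAlgebraic.tower_top (K := ℚ) K
  intro 𝔔 h𝔔 γ hγ
  haveI : 𝔔.IsPrime := h𝔔.1
  -- `𝔓 = ι⁻¹ 𝔔 ∣ v`, and `Φ = res γ` is a Frobenius at `𝔓` (`f(w|v) = 1`)
  have h𝔓 : 𝔔.comap (absIntegersMap K F) ∈ v.primesAbove := comap_absIntegersMap_mem_primesAbove hw h𝔔
  have hΦ : IsArithFrobAt (𝓞 K) (absGaloisRestrict K F γ) (𝔔.comap (absIntegersMap K F)) :=
    isArithFrobAt_absGaloisRestrict_of_inertiaDeg_eq_one hw h𝔔 hγ hfw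
  -- `Φ ∈ D_𝔓 ∩ res(Γ_F) ⊆ res₁(Γ_{F₁})`
  obtain ⟨δ, hδ⟩ : absGaloisRestrict K F γ ∈ (absGaloisRestrict K F₁).range :=
    hD _ h𝔓 _ (fun x hx ↦ smul_mem_of_isArithFrobAt h𝔓 hΦ hx) ⟨γ, rfl⟩
  replace hδ : absGaloisRestrict K F₁ δ = absGaloisRestrict K F γ := hδ
  -- `𝔔₁ = ι₁ 𝔓`, above a place `u ∣ v` of `F₁`, of residue degree `1`
  haveI : (𝔔.comap (absIntegersMap K F)).IsPrime := h𝔓.1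
  obtain ⟨𝔔₁, h𝔔₁prime, h𝔔₁⟩ :=
    exists_isPrime_comap_absIntegersMap_eq K F₁ (𝔔.comap (absIntegersMap K F))
  haveI := h𝔔₁prime
  obtain ⟨u, hu, h𝔔₁u, -⟩ :=
    exists_heightOneSpectrum_of_comap_absIntegersMap_mem_primesAbove (K := K) (M := F₁) (𝔔 := 𝔔₁)
      (h𝔔₁.symm ▸ h𝔓)
  have hΦ₁ : IsArithFrobAt (𝓞 K) (absGaloisRestrict K F₁ δ) (𝔔₁.comap (absIntegersMap K F₁)) := by
    rw [hδ, h𝔔₁]; exact hΦ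
  have hfu : u.asIdeal.inertiaDeg (𝓞 K) = 1 :=
    inertiaDeg_eq_one_of_isArithFrobAt_absGaloisRestrict hu h𝔔₁u hΦ₁
  -- so `δ` is a Frobenius of `F₁` at `𝔔₁`
  have hδFrob : IsArithFrobAt (𝓞 F₁) δ 𝔔₁ :=
    isArithFrobAt_of_absGaloisRestrict_eq_pow hu h𝔔₁u (Φ := absGaloisRestrict K F₁ δ) hΦ₁
      (by rw [hfu, pow_one])
  have h2 := h₁ u hu 𝔔₁ h𝔔₁u δ hδFrob
  unfold FramedRep.charpoly at h2 ⊢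
  rw [FramedGaloisRep.restrictField_apply] at h2 ⊢
  rw [← hδ]
  exact h2

end Transfer

end Literature.NumberTheory.GaloisRepresentations

namespace Literature.NumberTheory.Automorphic

open Literature.NumberTheory.GaloisRepresentations

/-! ## §2 The half-twist bookkeeping almost everywhere (no lang.S27) -/

section HalfTwistAE

variable {n : ℕ} {K : Type} [Field K] [NumberField K] {hcpt : isCompact_glFiniteIntegralLevel n K}
  {ℓ : ℕ} [Fact ℓ.Prime]

/-- **L-normalised compatibility with `π` a.e. is C-normalised compatibility with the half twist
`π ⊗ |det|^{(n-1)/2}` a.e.** (`t_{π',v} = q_v^{-(n-1)/2} t_{π,v}`,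
`HasSatakeParamAt.of_map_mulChar_detTwist_of_cpow`, and
`arithFrobPolyOfSatake ι q n (q^{-(n-1)/2} α) = arithFrobPolyOfSatake ι q 1 α`).
Buzzard–Gee 2014, §5.3. [cite: BuzzardGeeLMS2014, §2.1 and §5.3] -/
theorem eventually_satakeFrobCompatible_halfTwist [NeZero n] (ι : PadicAlgCl ℓ ≃+* ℂ)
    {π π' : AutomorphicRepData (AutomorphyDatum.gl n K hcpt)}
    (ρ : FramedGaloisRep K (PadicAlgCl ℓ) n)
    (hρ : ∀ᶠ v : HeightOneSpectrum (𝓞 K) in cofinite,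
      ∃ α : Multiset ℂ, π.HasSatakeParamAt v α ∧ ρ.IsUnramifiedAt v ∧
        ρ.HasFrobCharpolyAt v (arithFrobPolyOfSatake ι v.residueCard 1 α))
    {χ : HeckeCharacter K}
    (hχ : ∀ x : ideleGroup K, ((χ x : ℂˣ) : ℂ) = (ideleNorm x : ℂ) ^ ((((n : ℝ) - 1) / 2 : ℝ) : ℂ))
    (hW : π'.W = π.W.map (mulChar (detTwist n χ)))
    (hW' : π'.W' = π.W'.map (mulChar (detTwist n χ))) :
    ∀ᶠ v : HeightOneSpectrum (𝓞 K) in cofinite,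
      ∃ β : Multiset ℂ, π'.HasSatakeParamAt v β ∧ ρ.IsUnramifiedAt v ∧
        ρ.HasFrobCharpolyAt v (arithFrobPolyOfSatake ι v.residueCard n β) := by
  filter_upwards [hρ] with v ⟨α, hα, hur, hch⟩
  refine ⟨_, AutomorphicRepData.HasSatakeParamAt.of_map_mulChar_detTwist_of_cpow hχ hW hW' hα, hur,
    ?_⟩
  rwa [arithFrobPolyOfSatake_map_cpow_neg_half ι (Nat.zero_lt_of_lt v.one_lt_residueCard)
    NeZero.one_le]

/-- **Reading the L-normalised compatibility with `π` at `v` from the C-normalised compatibility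
with the half twist at `v`** (`IsGaloisCompatibleAt π' ι ρ v` applied to the Satake parameter
`q_v^{-(n-1)/2} α` of `π'`). Buzzard–Gee 2014, §5.3. [cite: BuzzardGeeLMS2014, §2.1 and §5.3] -/
theorem isUnramifiedAt_and_hasFrobCharpolyAt_one_of_isGaloisCompatibleAt_halfTwist [NeZero n]
    (ι : PadicAlgCl ℓ ≃+* ℂ) {π π' : AutomorphicRepData (AutomorphyDatum.gl n K hcpt)}
    (ρ : FramedGaloisRep K (PadicAlgCl ℓ) n) {χ : HeckeCharacter K}
    (hχ : ∀ x : ideleGroup K, ((χ x : ℂˣ) : ℂ) = (ideleNorm x : ℂ) ^ ((((n : ℝ) - 1) / 2 : ℝ) : ℂ))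
    (hW : π'.W = π.W.map (mulChar (detTwist n χ)))
    (hW' : π'.W' = π.W'.map (mulChar (detTwist n χ))) {v : HeightOneSpectrum (𝓞 K)}
    (hc : IsGaloisCompatibleAt π' ι ρ v) {α : Multiset ℂ} (hα : π.HasSatakeParamAt v α) :
    ρ.IsUnramifiedAt v ∧ ρ.HasFrobCharpolyAt v (arithFrobPolyOfSatake ι v.residueCard 1 α) := by
  obtain ⟨hur, hch⟩ :=
    hc _ (AutomorphicRepData.HasSatakeParamAt.of_map_mulChar_detTwist_of_cpow hχ hW hW' hα)
  rw [arithFrobPolyOfSatake_map_cpow_neg_half ι (Nat.zero_lt_of_lt v.one_lt_residueCard)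
    NeZero.one_le] at hch
  exact ⟨hur, hch⟩

end HalfTwistAE

/-! ## §3 Case A and the real-quadratic step, from Carayol's theorem in the a.e. form (C') -/

section Carayol

/- The hypothesis `hCar` below is Carayol's theorem in the form (C') of the module docstring:
Carayol 1986, Thm. (A) (pp. 410–411) with §0.5 (and Chebotarev–Brauer–Nesbitt); Taylor 1989/1990
for `[K:ℚ]` even at the places where `π` has no discrete series (Jarvis 1997, p. 18); Skinner 2009,
§1 (1).  It is a hypothesis, not a named fact of the tree (a proving seat may not vendor it). -/
variable
  (hCar : ∀ {K : Type} [Field K] [NumberField K] (hcpt : isCompact_glFiniteIntegralLevel 2 K),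
    IsTotallyReal K →
    ∀ (π : CuspidalAutomorphicRepData 2 K hcpt), π.1.IsRegularAlgebraic →
      ∀ (ℓ : ℕ) [Fact ℓ.Prime] (ι : PadicAlgCl ℓ ≃+* ℂ) (r : FramedGaloisRep K (PadicAlgCl ℓ) 2),
        r.toGaloisRep.IsIrreducible →
        (∀ᶠ v : HeightOneSpectrum (𝓞 K) in cofinite,
          ∃ α : Multiset ℂ, π.1.HasSatakeParamAt v α ∧ r.IsUnramifiedAt v ∧
            r.HasFrobCharpolyAt v (arithFrobPolyOfSatake ι v.residueCard 2 α)) →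
        ∀ w : HeightOneSpectrum (𝓞 K), ((ℓ : ℕ) : 𝓞 K) ∉ w.asIdeal →
          IsGaloisCompatibleAt π.1 ι r w ∧ (r.IsUnramifiedAt w → π.1.IsUnramifiedAt w))

variable {F : Type} [Field F] [NumberField F] {p : ℕ} [Fact p.Prime]
  {hQ : isCompact_glFiniteIntegralLevel 2 ℚ} {hF : isCompact_glFiniteIntegralLevel 2 F}

omit [Fact p.Prime] in
/-- `(p) ∤ w` in `𝓞 F` implies `(p) ∤ w ∩ 𝓞 ℚ`. [folklore] -/
private theorem natCast_not_mem_under₄ {w : HeightOneSpectrum (𝓞 F)}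
    (hwp : (p : 𝓞 F) ∉ w.asIdeal) : ((p : ℕ) : 𝓞 ℚ) ∉ (w.under (𝓞 ℚ)).asIdeal := by
  intro h
  apply hwp
  have h' : algebraMap (𝓞 ℚ) (𝓞 F) (p : 𝓞 ℚ) ∈ w.asIdeal := Ideal.mem_comap.mp h
  rwa [map_natCast] at h'

omit [Fact p.Prime] in
/-- `(p) ∤ u ∩ 𝓞 ℚ` implies `(p) ∤ u`, for a place `u` of any number field `K`. [folklore] -/
private theorem natCast_not_mem_of_under₄ {K : Type} [Field K] [NumberField K]
    {u : HeightOneSpectrum (𝓞 K)} {v : HeightOneSpectrum (𝓞 ℚ)}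
    (hu : u.asIdeal.under (𝓞 ℚ) = v.asIdeal) (hv : ((p : ℕ) : 𝓞 ℚ) ∉ v.asIdeal) :
    (p : 𝓞 K) ∉ u.asIdeal := by
  intro h
  apply hv
  rw [← hu, Ideal.under, Ideal.mem_comap, map_natCast]
  exact h

include hCar in
/-- **The step over a REAL quadratic field, from (C')** (variant of
`Langlands1980_quadraticBaseChange_frobCompatible_at_of_isTotallyReal` of `…CarayolProofs` without
lang.S27): with the data of the fact, if `F` is totally real and `ρ|_{Γ_F}` is irreducible, then at
every finite `w ∤ p` at which `ρ|_{Γ_F}` is unramified, `P` has a Satake parameter `α` at `w` and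
the arithmetic Frobenii of `ρ|_{Γ_F}` at `w` have characteristic polynomial
`arithFrobPolyOfSatake ι q_w 1 α`.  (`P` has the regular L-algebraic infinity type `T^F`,
`hasInfinityType_baseChange`; `ρ|_{Γ_F}` is a.e. compatible with `P`, hence a.e. C-compatible with
the regular algebraic `P' = P ⊗ |det|^{1/2}`; (C') over `F` at `w`: `P'`, hence `P`, is unramified
at `w`, and the compatibility with `P'` at `w` is the compatibility with `P` in the
L-normalisation.) [cite: CarayolASENS1986, Thm. (A) (pp. 410–411) with §0.5]
[cite: ArthurClozelAMS120, Ch. 3 Thm. 5.1 and Ch. 1 §7] [cite: BuzzardGeeLMS2014, §5.3] -/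
theorem Langlands1980_quadraticBaseChange_frobCompatible_at_of_isTotallyReal'
    (hArch : ArthurClozel1989_strongLifting_archimedean)
    (hF2 : Module.finrank ℚ F = 2) (hFR : IsTotallyReal F) (ι : PadicAlgCl p ≃+* ℂ)
    (π : CuspidalAutomorphicRepData 2 ℚ hQ) {T : InfinityType ℚ 2} (hT : π.1.HasInfinityType T)
    (hTL : T.IsLAlgebraic) (hTR : T.IsRegular) (ρ : FramedGaloisRep ℚ (PadicAlgCl p) 2)
    (hirrF : (ρ.restrictField F).toGaloisRep.IsIrreducible)
    (hρ : ∀ᶠ v : HeightOneSpectrum (𝓞 ℚ) in cofinite,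
      ∃ α : Multiset ℂ, π.1.HasSatakeParamAt v α ∧ ρ.IsUnramifiedAt v ∧
        ρ.HasFrobCharpolyAt v (arithFrobPolyOfSatake ι v.residueCard 1 α))
    (P : CuspidalAutomorphicRepData 2 F hF) (hBC : IsWeakBaseChangeLiftAE π.1 P.1)
    (w : HeightOneSpectrum (𝓞 F)) (hwp : (p : 𝓞 F) ∉ w.asIdeal)
    (hunr : (ρ.restrictField F).IsUnramifiedAt w) :
    ∃ α : Multiset ℂ, P.1.HasSatakeParamAt w α ∧ (ρ.restrictField F).IsUnramifiedAt w ∧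
      (ρ.restrictField F).HasFrobCharpolyAt w (arithFrobPolyOfSatake ι w.residueCard 1 α) := by
  haveI : Algebra.IsQuadraticExtension ℚ F := ⟨hF2⟩
  haveI : IsGalois ℚ F := inferInstance
  have hprime : (Module.finrank ℚ F).Prime := hF2 ▸ Nat.prime_two
  haveI : IsCyclic (F ≃ₐ[ℚ] F) :=
    isCyclic_of_prime_card (p := Module.finrank ℚ F) (hp := ⟨hprime⟩) (IsGalois.card_aut_eq_finrank ℚ F)
  -- `P` has the regular L-algebraic infinity type `T^F`
  have hTP : P.1.HasInfinityType (T.baseChange F) :=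
    hArch.hasInfinityType_baseChange inferInstance hprime hBC hT
  -- `ρ|_{Γ_F}` is a.e. compatible with `P`
  have hρF := eventually_satakeFrobCompatible_restrictField_of_isWeakBaseChangeLiftAE ι 1 π.1 P.1 hBC
    ρ hρ
  -- the twist `P' = P ⊗ |det|^{1/2}`, regular algebraic, a.e. C-compatible with `ρ|_{Γ_F}`
  obtain ⟨χ, P', hχ, hW, hW', hT'⟩ := P.exists_twist_hasInfinityType (((2 : ℝ) - 1) / 2) hTP
  have hreg' : P'.1.IsRegularAlgebraic :=
    isRegularAlgebraic_of_hasInfinityType_twist_half (n := 2) (by exact_mod_cast hT')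
      hTL.baseChange hTR.baseChange
  have hχ' : ∀ x : ideleGroup F,
      ((χ x : ℂˣ) : ℂ) = (ideleNorm x : ℂ) ^ (((((2 : ℕ) : ℝ) - 1) / 2 : ℝ) : ℂ) := by
    exact_mod_cast hχ
  have hρF' := eventually_satakeFrobCompatible_halfTwist (n := 2) ι (ρ.restrictField F) hρF hχ' hW hW'
  -- (C') over `F` at `w`
  obtain ⟨hc, himp⟩ := hCar hF hFR P' hreg' p ι (ρ.restrictField F) hirrF hρF' w hwp
  obtain ⟨α, hα⟩ : P.1.IsUnramifiedAt w := (isUnramifiedAt_iff_of_twist hχ hW hW' w).mp (himp hunr)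
  exact ⟨α, hα, isUnramifiedAt_and_hasFrobCharpolyAt_one_of_isGaloisCompatibleAt_halfTwist (n := 2) ι
    (ρ.restrictField F) hχ' hW hW' hc hα⟩

include hCar in
/-- **Case A of the residue, from (C')** (variant of
`Langlands1980_quadraticBaseChange_frobCompatible_at_of_isUnramifiedIn'` of `…AuxFieldProofs`
without lang.S27): with the data of the fact, if `ℓ = w ∩ ℤ` is UNRAMIFIED in `F` then the
conclusion holds at `w`.  `ρ` is unramified at `ℓ` (Galois descent along `F/ℚ`); (C') over `ℚ`,
applied to the regular algebraic `π ⊗ |det|^{1/2}` (a.e. C-compatible with `ρ`), gives at `ℓ`: `π`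
unramified at `ℓ` and the Frobenius polynomial of `ρ` at `ℓ`; this ascends to `w`
(`hasFrobCharpolyAt_restrictField_arithFrobPolyOfSatake`) and the relation (1.1) at `w ∣ ℓ`, `ℓ`
unramified in `F`, gives `t_{P,w} = t_{π,ℓ}^{f(w|ℓ)}` (`ArthurClozel1989_strongLifting_unramified` (i)).
[cite: CarayolASENS1986, Thm. (A) (pp. 410–411) with §0.5]
[cite: ArthurClozelAMS120, Ch. 3 Thm. 5.1 with §1 (1.1) and Def. 1.2] -/
theorem Langlands1980_quadraticBaseChange_frobCompatible_at_of_isUnramifiedIn''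
    (hACu : ArthurClozel1989_strongLifting_unramified)
    (hF2 : Module.finrank ℚ F = 2) (ι : PadicAlgCl p ≃+* ℂ)
    (π : CuspidalAutomorphicRepData 2 ℚ hQ) {T : InfinityType ℚ 2} (hT : π.1.HasInfinityType T)
    (hTL : T.IsLAlgebraic) (hTR : T.IsRegular) (ρ : FramedGaloisRep ℚ (PadicAlgCl p) 2)
    (hirr : ρ.toGaloisRep.IsIrreducible)
    (hρ : ∀ᶠ v : HeightOneSpectrum (𝓞 ℚ) in cofinite,
      ∃ α : Multiset ℂ, π.1.HasSatakeParamAt v α ∧ ρ.IsUnramifiedAt v ∧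
        ρ.HasFrobCharpolyAt v (arithFrobPolyOfSatake ι v.residueCard 1 α))
    (P : CuspidalAutomorphicRepData 2 F hF) (hBC : IsWeakBaseChangeLiftAE π.1 P.1)
    (w : HeightOneSpectrum (𝓞 F)) (hwp : (p : 𝓞 F) ∉ w.asIdeal)
    (hℓF : Algebra.IsUnramifiedIn (𝓞 F) (w.under (𝓞 ℚ)).asIdeal)
    (hunr : (ρ.restrictField F).IsUnramifiedAt w) :
    ∃ α : Multiset ℂ, P.1.HasSatakeParamAt w α ∧ (ρ.restrictField F).IsUnramifiedAt w ∧
      (ρ.restrictField F).HasFrobCharpolyAt w (arithFrobPolyOfSatake ι w.residueCard 1 α) := by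
  haveI : Algebra.IsQuadraticExtension ℚ F := ⟨hF2⟩
  haveI : IsGalois ℚ F := inferInstance
  have hprime : (Module.finrank ℚ F).Prime := hF2 ▸ Nat.prime_two
  -- `ρ` is unramified at `ℓ = w ∩ ℤ`
  have hρℓ : ρ.IsUnramifiedAt (w.under (𝓞 ℚ)) :=
    ρ.isUnramifiedAt_of_restrictField_of_under_eq hℓF rfl hunr
  -- (C') over `ℚ` for the regular algebraic twist `π' = π ⊗ |det|^{1/2}`
  obtain ⟨χ, π', hχ, hW, hW', hT'⟩ := π.exists_twist_hasInfinityType (((2 : ℝ) - 1) / 2) hT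
  have hreg' : π'.1.IsRegularAlgebraic :=
    isRegularAlgebraic_of_hasInfinityType_twist_half (n := 2) (by exact_mod_cast hT') hTL hTR
  have hχ' : ∀ x : ideleGroup ℚ,
      ((χ x : ℂˣ) : ℂ) = (ideleNorm x : ℂ) ^ (((((2 : ℕ) : ℝ) - 1) / 2 : ℝ) : ℂ) := by
    exact_mod_cast hχ
  have hρ' := eventually_satakeFrobCompatible_halfTwist (n := 2) ι ρ hρ hχ' hW hW'
  obtain ⟨hc, himp⟩ := hCar hQ inferInstance π' hreg' p ι ρ hirr hρ' _ (natCast_not_mem_under₄ hwp)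
  obtain ⟨α, hα⟩ : π.1.IsUnramifiedAt (w.under (𝓞 ℚ)) :=
    (isUnramifiedAt_iff_of_twist hχ hW hW' _).mp (himp hρℓ)
  obtain ⟨hur, hch⟩ := isUnramifiedAt_and_hasFrobCharpolyAt_one_of_isGaloisCompatibleAt_halfTwist
    (n := 2) ι ρ hχ' hW hW' hc hα
  exact ⟨_, (hACu.isUnramifiedBaseChangeLift hprime hBC).hasSatakeParamAt w hℓF hα,
    hasFrobCharpolyAt_restrictField_arithFrobPolyOfSatake (L := F) ι ρ (v := w.under (𝓞 ℚ))
      (w := w) rfl hur 1 hch⟩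

/-! ## §4 Case B with the auxiliary fields abstract, split at `w` -/

/-- A place of a finite extension `M` above the place `w` of `F` exists. [folklore] -/
private theorem exists_place_under_eq {F M : Type*} [Field F] [NumberField F] [Field M]
    [NumberField M] [Algebra F M] (w : HeightOneSpectrum (𝓞 F)) :
    ∃ ω : HeightOneSpectrum (𝓞 M), ω.asIdeal.under (𝓞 F) = w.asIdeal := by
  haveI : w.asIdeal.IsMaximal := w.isMaximal
  obtain ⟨Q, hQmax, hQover⟩ :=
    Ideal.exists_maximal_ideal_liesOver_of_isIntegral (S := 𝓞 M) w.asIdeal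
  haveI := hQmax.isPrime
  exact ⟨⟨Q, hQmax.isPrime, Ideal.ne_bot_of_mem_primesOver w.ne_bot ⟨hQmax.isPrime, hQover⟩⟩,
    hQover.over.symm⟩

include hCar in
/-- **Case B of the residue, the auxiliary fields being given and SPLIT above `ℓ`** (variant of
`Langlands1980_quadraticBaseChange_frobCompatible_at_of_auxField` without lang.S27).  With the
data of `Langlands1980_quadraticBaseChange_frobCompatible` (`F/ℚ` quadratic, `π`, `T`, `ρ`
irreducible and a.e. compatible, `P` a cuspidal weak base change, `w ∤ p` with `ρ|_{Γ_F}`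
unramified at `w`), suppose given a real quadratic field `F₁` and a field `M ⊇ F, F₁`, quadratic
over both, such that, writing `v = w ∩ ℤ`: the inertia groups of `Γ_ℚ` above `v` meet `res(Γ_{F₁})`
inside `res(Γ_F)` (`hI`) and the elements of `res(Γ_F)` mapping a prime above `v` into itself lie
in `res(Γ_{F₁})` (`hD`); `w` is the only place of `F` above `v` (`huniq`) and `f(w|v) = 1` (`hfw`);
some `g ∈ Γ_ℚ ∖ res(Γ_{F₁})` has `tr ρ(g) ≠ 0` (`hg`); some `γ ∈ Γ_F ∖ res(Γ_M)` has `tr ρ(γ) ≠ 0`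
(`hγ`); `w` is unramified and split in `M` (`hwM`, `hsplitF`), and so is every place of `F₁` above
`v` (`huM`, `hsplitF₁`).  Then, granted (C'), Arthur–Clozel's archimedean lifting, cuspidal cyclic
base change and the unramified strong lifting, `P` has a Satake parameter `α` at `w` and the
arithmetic Frobenii of `ρ|_{Γ_F}` at `w` have characteristic polynomial
`arithFrobPolyOfSatake ι q_w 1 α`.  Steps: (1) `P₁ = BC_{F₁/ℚ}(π)` cuspidal, `ρ|_{Γ_{F₁}}`
irreducible; (2) at every `u ∣ v` of `F₁`, `ρ|_{Γ_{F₁}}` is unramified, so by the real-quadratic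
step `P₁` has a Satake parameter `α₁(u)` with the Frobenius polynomial of `ρ|_{Γ_{F₁}}` at `u`;
(3) `𝒫 = BC_{M/F}(P)` is a weak lift of `P₁` along `M/F₁`, unramified above `ℓ`; (4) `P` is
unramified at `w` with parameter `α` (descent), and at any `ω ∣ u` of `M` (which lies over `w`),
`t_{𝒫,ω} = α^{f(ω|w)} = α = α₁(u)^{f(ω|u)} = α₁(u)` — so the Frobenius polynomial of `ρ|_{Γ_{F₁}}`
at every `u ∣ v` is `arithFrobPolyOfSatake ι q_w 1 α` (`q_u = q_v = q_w`), which transfers to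
`ρ|_{Γ_F}` at `w`. [cite: LanglandsBaseChange1980, §2 (A), (F) (pp. 19–20)]
[cite: ArthurClozelAMS120, Ch. 3 Thm. 4.2 (a), Thm. 5.1 with §1 (1.1), §6 proof of Lemma 6.3]
[cite: CarayolASENS1986, Thm. (A) (pp. 410–411) with §0.5] -/
theorem Langlands1980_quadraticBaseChange_frobCompatible_at_of_auxField'
    (hArch : ArthurClozel1989_strongLifting_archimedean)
    (hBCc : baseChange_cyclic_cuspidal) (hACu : ArthurClozel1989_strongLifting_unramified)
    (hF2 : Module.finrank ℚ F = 2) (ι : PadicAlgCl p ≃+* ℂ)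
    (π : CuspidalAutomorphicRepData 2 ℚ hQ) {T : InfinityType ℚ 2} (hT : π.1.HasInfinityType T)
    (hTL : T.IsLAlgebraic) (hTR : T.IsRegular) (ρ : FramedGaloisRep ℚ (PadicAlgCl p) 2)
    (hirr : ρ.toGaloisRep.IsIrreducible)
    (hρ : ∀ᶠ v : HeightOneSpectrum (𝓞 ℚ) in cofinite,
      ∃ α : Multiset ℂ, π.1.HasSatakeParamAt v α ∧ ρ.IsUnramifiedAt v ∧
        ρ.HasFrobCharpolyAt v (arithFrobPolyOfSatake ι v.residueCard 1 α))
    (P : CuspidalAutomorphicRepData 2 F hF) (hBC : IsWeakBaseChangeLiftAE π.1 P.1)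
    (w : HeightOneSpectrum (𝓞 F)) (hwp : (p : 𝓞 F) ∉ w.asIdeal)
    (hunr : (ρ.restrictField F).IsUnramifiedAt w)
    (F₁ : Type) [Field F₁] [NumberField F₁] (hF₁2 : Module.finrank ℚ F₁ = 2)
    (hF₁R : IsTotallyReal F₁) (M : Type) [Field M] [NumberField M] [Algebra F M] [Algebra F₁ M]
    [IsScalarTower ℚ F₁ M] (hFM : Module.finrank F M = 2) (hF₁M : Module.finrank F₁ M = 2)
    (hI : ∀ 𝔓 ∈ (w.under (𝓞 ℚ)).primesAbove,
      𝔓.inertia (absoluteGaloisGroup ℚ) ⊓ (absGaloisRestrict ℚ F₁).range ≤ (absGaloisRestrict ℚ F).range)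
    (hD : ∀ 𝔓 ∈ (w.under (𝓞 ℚ)).primesAbove, ∀ g : absoluteGaloisGroup ℚ, (∀ x ∈ 𝔓, g • x ∈ 𝔓) →
      g ∈ (absGaloisRestrict ℚ F).range → g ∈ (absGaloisRestrict ℚ F₁).range)
    (huniq : ∀ w' : HeightOneSpectrum (𝓞 F), w'.asIdeal.under (𝓞 ℚ) = (w.under (𝓞 ℚ)).asIdeal → w' = w)
    (hfw : w.asIdeal.inertiaDeg (𝓞 ℚ) = 1)
    (hg : ∃ g : absoluteGaloisGroup ℚ, g ∉ (absGaloisRestrict ℚ F₁).range ∧ FramedRep.trace ρ g ≠ 0)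
    (hγ : ∃ γ : absoluteGaloisGroup F,
      γ ∉ (absGaloisRestrict F M).range ∧ FramedRep.trace (ρ.restrictField F) γ ≠ 0)
    (hwM : Algebra.IsUnramifiedIn (𝓞 M) w.asIdeal) (hsplitF : w.asIdeal.inertiaDegIn (𝓞 M) = 1)
    (huM : ∀ u : HeightOneSpectrum (𝓞 F₁), u.asIdeal.under (𝓞 ℚ) = (w.under (𝓞 ℚ)).asIdeal →
      Algebra.IsUnramifiedIn (𝓞 M) u.asIdeal)
    (hsplitF₁ : ∀ u : HeightOneSpectrum (𝓞 F₁), u.asIdeal.under (𝓞 ℚ) = (w.under (𝓞 ℚ)).asIdeal →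
      u.asIdeal.inertiaDegIn (𝓞 M) = 1) :
    ∃ α : Multiset ℂ, P.1.HasSatakeParamAt w α ∧ (ρ.restrictField F).IsUnramifiedAt w ∧
      (ρ.restrictField F).HasFrobCharpolyAt w (arithFrobPolyOfSatake ι w.residueCard 1 α) := by
  -- degrees, Galois groups
  haveI : Algebra.IsQuadraticExtension ℚ F := ⟨hF2⟩
  haveI : IsGalois ℚ F := inferInstance
  have hprime : (Module.finrank ℚ F).Prime := hF2 ▸ Nat.prime_two
  haveI : Algebra.IsQuadraticExtension ℚ F₁ := ⟨hF₁2⟩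
  haveI : IsGalois ℚ F₁ := inferInstance
  have hprime₁ : (Module.finrank ℚ F₁).Prime := hF₁2 ▸ Nat.prime_two
  haveI : FiniteDimensional F M := Module.finite_of_finrank_pos (by rw [hFM]; exact two_pos)
  haveI : Algebra.IsQuadraticExtension F M := ⟨hFM⟩
  haveI : IsGalois F M := inferInstance
  have hprimeM : (Module.finrank F M).Prime := hFM ▸ Nat.prime_two
  haveI : FiniteDimensional F₁ M := Module.finite_of_finrank_pos (by rw [hF₁M]; exact two_pos)
  haveI : Algebra.IsQuadraticExtension F₁ M := ⟨hF₁M⟩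
  haveI : IsGalois F₁ M := inferInstance
  have hprimeM₁ : (Module.finrank F₁ M).Prime := hF₁M ▸ Nat.prime_two
  set v : HeightOneSpectrum (𝓞 ℚ) := w.under (𝓞 ℚ) with hvdef
  have hwv : w.asIdeal.under (𝓞 ℚ) = v.asIdeal := rfl
  have hvp : ((p : ℕ) : 𝓞 ℚ) ∉ v.asIdeal := natCast_not_mem_under₄ hwp
  -- (1) the cuspidal base change `P₁` of `π` to `F₁`, and `ρ|_{Γ_{F₁}}` irreducible
  obtain ⟨g, hg, hgtr⟩ := hg
  have hirr₁ : (ρ.restrictField F₁).toGaloisRep.IsIrreducible :=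
    ρ.isIrreducible_restrictField_of_trace_ne_zero F₁ hF₁2 hirr hg hgtr
  have hne₁ := exists_inert_hasSatakeParamAt_map_ne_of_trace_ne_zero F₁ hF₁2 ι π.1 ρ hρ ⟨g, hg, hgtr⟩
  obtain ⟨P₁, hBC₁⟩ := hBCc 2 ℚ F₁ hprime₁ hQ π hne₁ (isCompact_glFiniteIntegralLevel_holds 2 F₁)
  -- (2) at every place `u` of `F₁` above `v`: `P₁` is unramified, with the Frobenius polynomial
  have hP₁u : ∀ u : HeightOneSpectrum (𝓞 F₁), u.asIdeal.under (𝓞 ℚ) = v.asIdeal →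
      ∃ α₁ : Multiset ℂ, P₁.1.HasSatakeParamAt u α₁ ∧
        (ρ.restrictField F₁).HasFrobCharpolyAt u (arithFrobPolyOfSatake ι u.residueCard 1 α₁) := by
    intro u hu
    have hunr₁ : (ρ.restrictField F₁).IsUnramifiedAt u :=
      ρ.isUnramifiedAt_restrictField_of_inertia_inf_range_le hI huniq hunr hu
    obtain ⟨α₁, hα₁, -, hch₁⟩ := Langlands1980_quadraticBaseChange_frobCompatible_at_of_isTotallyReal'
      hCar hArch hF₁2 hF₁R ι π hT hTL hTR ρ hirr₁ hρ P₁ hBC₁ u (natCast_not_mem_of_under₄ hu hvp) hunr₁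
    exact ⟨α₁, hα₁, hch₁⟩
  -- (3) the cuspidal base change `𝒫` of `P` to `M`; it is a weak lift of `P₁` along `M/F₁`
  have hρF := eventually_satakeFrobCompatible_restrictField_of_isWeakBaseChangeLiftAE ι 1 π.1 P.1
    hBC ρ hρ
  have hneM := exists_inert_hasSatakeParamAt_map_ne_of_trace_ne_zero M hFM ι P.1
    (ρ.restrictField F) hρF hγ
  obtain ⟨PM, hBCM⟩ := hBCc 2 F M hprimeM hF P hneM (isCompact_glFiniteIntegralLevel_holds 2 M)
  have hBC₁M : IsWeakBaseChangeLiftAE P₁.1 PM.1 :=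
    IsWeakBaseChangeLiftAE.of_isWeakBaseChangeLiftAE_left hBC₁ (hBC.trans hBCM)
  -- `𝒫` is unramified at every place of `M` above `w`
  have hPMω : ∀ ω : HeightOneSpectrum (𝓞 M), ω.asIdeal.under (𝓞 F) = w.asIdeal →
      PM.1.IsUnramifiedAt ω := by
    intro ω hω
    have hu : (ω.under (𝓞 F₁)).asIdeal.under (𝓞 ℚ) = v.asIdeal := by
      change (ω.asIdeal.under (𝓞 F₁)).under (𝓞 ℚ) = w.asIdeal.under (𝓞 ℚ)
      rw [Ideal.under_under, ← hω, Ideal.under_under]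
    obtain ⟨α₁, hα₁, -⟩ := hP₁u _ hu
    exact (hACu.isUnramifiedBaseChangeLift hprimeM₁ hBC₁M).isUnramifiedAt rfl (huM _ hu) ⟨α₁, hα₁⟩
  -- (4) descent: `P` is unramified at `w`, with parameter `α`
  obtain ⟨α, hα⟩ : P.1.IsUnramifiedAt w := hACu.isUnramifiedAt_of_forall hprimeM hBCM hwM hPMω
  refine ⟨α, hα, hunr, ?_⟩
  -- all places of `F₁` above `v` have residue degree `1`; `q_w = q_v`
  have hfF₁ : v.asIdeal.inertiaDegIn (𝓞 F₁) = 1 :=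
    inertiaDegIn_eq_one_of_smul_mem_of_mem_range hD hwv hfw
  have hqw : w.residueCard = v.residueCard := by
    rw [residueCard_eq_residueCard_pow_inertiaDeg hwv, hfw, pow_one]
  -- the Frobenius polynomial of `ρ|_{Γ_{F₁}}` at every `u ∣ v` is `arithFrobPolyOfSatake ι q_w 1 α`
  have key : ∀ u : HeightOneSpectrum (𝓞 F₁), u.asIdeal.under (𝓞 ℚ) = v.asIdeal →
      (ρ.restrictField F₁).HasFrobCharpolyAt u (arithFrobPolyOfSatake ι w.residueCard 1 α) := by
    intro u hu
    obtain ⟨α₁, hα₁, hch₁⟩ := hP₁u u hu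
    -- a place `ω` of `M` above `u`; it lies above `w`
    obtain ⟨ω, hωu⟩ := exists_place_under_eq (M := M) u
    have hωw : ω.asIdeal.under (𝓞 F) = w.asIdeal := by
      have h1 : (ω.under (𝓞 F)).asIdeal.under (𝓞 ℚ) = v.asIdeal := by
        change (ω.asIdeal.under (𝓞 F)).under (𝓞 ℚ) = v.asIdeal
        rw [Ideal.under_under, ← Ideal.under_under (B := 𝓞 F₁), hωu, hu]
      exact congrArg HeightOneSpectrum.asIdeal (huniq _ h1)
    -- `t_{𝒫,ω} = α^{f(ω|w)} = α` and `t_{𝒫,ω} = α₁^{f(ω|u)} = α₁`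
    have h1 := hACu.hasSatakeParamAt_pow hprimeM hBCM hωw hwM hα
    have h2 := hACu.hasSatakeParamAt_pow hprimeM₁ hBC₁M hωu (huM u hu) hα₁
    rw [inertiaDeg_eq_inertiaDegIn hωw, hsplitF] at h1
    rw [inertiaDeg_eq_inertiaDegIn hωu, hsplitF₁ u hu] at h2
    simp only [pow_one, Multiset.map_id'] at h1 h2
    have hαα : α₁ = α := PM.1.hasSatakeParamAt_unique_holds h2 h1
    have hqu : u.residueCard = w.residueCard := by
      rw [residueCard_eq_residueCard_pow_inertiaDeg hu, inertiaDeg_eq_inertiaDegIn hu, hfF₁, pow_one,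
        hqw]
    rw [hαα, hqu] at hch₁
    exact hch₁
  exact ρ.hasFrobCharpolyAt_restrictField_of_smul_mem_of_mem_range hD hwv hfw key

end Carayol

end Literature.NumberTheory.Automorphic

/-! ## §5 Case B with the concrete auxiliary fields, and the assembly of the named fact -/

namespace Literature.NumberTheory.Automorphic

open Literature.NumberTheory.GaloisRepresentations

section CaseB

variable
  (hCar : ∀ {K : Type} [Field K] [NumberField K] (hcpt : isCompact_glFiniteIntegralLevel 2 K),
    IsTotallyReal K →
    ∀ (π : CuspidalAutomorphicRepData 2 K hcpt), π.1.IsRegularAlgebraic →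
      ∀ (ℓ : ℕ) [Fact ℓ.Prime] (ι : PadicAlgCl ℓ ≃+* ℂ) (r : FramedGaloisRep K (PadicAlgCl ℓ) 2),
        r.toGaloisRep.IsIrreducible →
        (∀ᶠ v : HeightOneSpectrum (𝓞 K) in cofinite,
          ∃ α : Multiset ℂ, π.1.HasSatakeParamAt v α ∧ r.IsUnramifiedAt v ∧
            r.HasFrobCharpolyAt v (arithFrobPolyOfSatake ι v.residueCard 2 α)) →
        ∀ w : HeightOneSpectrum (𝓞 K), ((ℓ : ℕ) : 𝓞 K) ∉ w.asIdeal →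
          IsGaloisCompatibleAt π.1 ι r w ∧ (r.IsUnramifiedAt w → π.1.IsUnramifiedAt w))

variable {F : Type} [Field F] [NumberField F] {p : ℕ} [Fact p.Prime]
  {hQ : isCompact_glFiniteIntegralLevel 2 ℚ} {hF : isCompact_glFiniteIntegralLevel 2 F}

include hCar in
/-- **Case B of the residue, from (C'): the fact at every `w ∤ p` over a prime RAMIFIED in `F`**
(granted (C'), Arthur–Clozel's archimedean and unramified strong lifting, and cuspidal cyclic base
change; variant of `Langlands1980_quadraticBaseChange_frobCompatible_at_of_not_isUnramifiedIn`
without lang.S27).  With the data of the fact, suppose `ℓ = w ∩ ℤ` ramifies in `F = ℚ(√c)` (so `w`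
is the unique place above it, of residue degree `1`).  Choose five primes `qⱼ > B` with
`qⱼ ≡ sign c (mod 8ℓ)` (Dirichlet) and put `mⱼ = (sign c) qⱼ ≡ 1 (mod 8ℓ)`; some `γ ∈ Γ_F` negates
`√mⱼ` with `tr ρ(γ) ≠ 0` (`FramedGaloisRep.exists_smul_eq_neg_and_trace_ne_zero`); with this
`m = mⱼ = 4k + 1` (`2ℓ ∣ k`) put `F₁ = ℚ(√(c m))` (real) and `M = F(√m)`.  The side conditions of
`…_at_of_auxField'` hold: inertia above `ℓ` fixes `√m` (`m ≡ 1 (mod 4)`, `(m, ℓ) = 1`) and the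
decomposition elements above `ℓ` fix `√m` (`ℓ ∣ k`: `smul_eq_self_of_smul_mem_of_sq_eq`), so that
`I_𝔓 ∩ res(Γ_{F₁}) ⊆ res(Γ_F)` and `D_𝔓 ∩ res(Γ_F) ⊆ res(Γ_{F₁})`; `w` and the places of `F₁` above
`ℓ` are unramified (`isUnramifiedIn_of_sq_eq_intCast`) and split (`inertiaDegIn_eq_one_of_sq_eq_intCast`)
in `M`; and `γ` furnishes both non-dihedrality witnesses.
[cite: LanglandsBaseChange1980, §2 (A), (F) (pp. 19–20)]
[cite: ArthurClozelAMS120, Ch. 3 Thm. 4.2 (a), Thm. 5.1] [cite: CarayolASENS1986, Thm. (A) (pp. 410–411) with §0.5] -/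
theorem Langlands1980_quadraticBaseChange_frobCompatible_at_of_not_isUnramifiedIn'
    (hArch : ArthurClozel1989_strongLifting_archimedean)
    (hBCc : baseChange_cyclic_cuspidal) (hACu : ArthurClozel1989_strongLifting_unramified)
    (hF2 : Module.finrank ℚ F = 2) (ι : PadicAlgCl p ≃+* ℂ)
    (π : CuspidalAutomorphicRepData 2 ℚ hQ) {T : InfinityType ℚ 2} (hT : π.1.HasInfinityType T)
    (hTL : T.IsLAlgebraic) (hTR : T.IsRegular) (ρ : FramedGaloisRep ℚ (PadicAlgCl p) 2)
    (hirr : ρ.toGaloisRep.IsIrreducible)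
    (hρ : ∀ᶠ v : HeightOneSpectrum (𝓞 ℚ) in cofinite,
      ∃ α : Multiset ℂ, π.1.HasSatakeParamAt v α ∧ ρ.IsUnramifiedAt v ∧
        ρ.HasFrobCharpolyAt v (arithFrobPolyOfSatake ι v.residueCard 1 α))
    (P : CuspidalAutomorphicRepData 2 F hF) (hBC : IsWeakBaseChangeLiftAE π.1 P.1)
    (w : HeightOneSpectrum (𝓞 F)) (hwp : (p : 𝓞 F) ∉ w.asIdeal)
    (hram : ¬ Algebra.IsUnramifiedIn (𝓞 F) (w.under (𝓞 ℚ)).asIdeal)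
    (hunr : (ρ.restrictField F).IsUnramifiedAt w) :
    ∃ α : Multiset ℂ, P.1.HasSatakeParamAt w α ∧ (ρ.restrictField F).IsUnramifiedAt w ∧
      (ρ.restrictField F).HasFrobCharpolyAt w (arithFrobPolyOfSatake ι w.residueCard 1 α) := by
  -- (0) `F = ℚ(√c)`, Galois of prime degree; `w` is the only place above `v = w ∩ ℤ`, `f(w|v) = 1`
  haveI : Algebra.IsQuadraticExtension ℚ F := ⟨hF2⟩
  haveI : IsGalois ℚ F := inferInstance
  have hprime : (Module.finrank ℚ F).Prime := hF2 ▸ Nat.prime_two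
  set v : HeightOneSpectrum (𝓞 ℚ) := w.under (𝓞 ℚ) with hvdef
  have huniq : ∀ w' : HeightOneSpectrum (𝓞 F), w'.asIdeal.under (𝓞 ℚ) = v.asIdeal → w' = w :=
    fun w' hw' ↦ HeightOneSpectrum.eq_of_not_isUnramifiedIn_of_prime hprime hram hw' rfl
  have hfw : w.asIdeal.inertiaDeg (𝓞 ℚ) = 1 :=
    HeightOneSpectrum.inertiaDeg_eq_one_of_not_isUnramifiedIn hprime (rfl : w.asIdeal.under (𝓞 ℚ) = v.asIdeal) hram
  obtain ⟨θ, c, hθ, hc⟩ := QuadraticFields.Quadratic.exists_sq_eq_algebraMap (F := ℚ) (K := F) hF2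
  have hc0 : c ≠ 0 := QuadraticFields.Quadratic.sq_ne_zero_of_not_mem_range hθ hc
  have hθ0 : θ ≠ 0 := QuadraticFields.Quadratic.ne_zero_of_not_mem_range hθ
  -- (1) five primes `q ≡ sign c (mod 8N)` beyond `B`, and `mⱼ = (sign c) qⱼ ≡ 1 (mod 8N)`
  set N : ℕ := Ideal.absNorm v.asIdeal with hNdef
  have hN0 : 0 < N := Nat.pos_of_ne_zero fun h ↦ v.ne_bot (Ideal.absNorm_eq_zero_iff.mp h)
  haveI : NeZero (8 * N) := ⟨by omega⟩
  set ε : ℤ := if 0 < c then 1 else -1 with hεdef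
  have hε : ε = 1 ∨ ε = -1 := by rw [hεdef]; split_ifs <;> simp
  have hεsq : ε * ε = 1 := by rcases hε with h | h <;> simp [h]
  set a : ZMod (8 * N) := (ε : ZMod (8 * N)) with hadef
  have ha : IsUnit a := isUnit_iff_exists_inv.mpr ⟨a, by rw [hadef, ← Int.cast_mul, hεsq, Int.cast_one]⟩
  set B : ℕ := max N (max c.num.natAbs c.den) with hBdef
  set S : Set ℕ := {q | q.Prime ∧ (q : ZMod (8 * N)) = a} ∩ {q | B < q} with hSdef
  have hSinf : S.Infinite := Set.infinite_of_forall_exists_gt fun n ↦ by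
    obtain ⟨q, hq, hqp, hqa⟩ := Nat.forall_exists_prime_gt_and_eq_mod ha (max n B)
    exact ⟨q, ⟨⟨hqp, hqa⟩, lt_of_le_of_lt (le_max_right _ _) hq⟩, lt_of_le_of_lt (le_max_left _ _) hq⟩
  set qs : Fin 5 → ℕ := fun j ↦ (Set.Infinite.natEmbedding S hSinf j).1 with hqsdef
  have hqS : ∀ j, qs j ∈ S := fun j ↦ (Set.Infinite.natEmbedding S hSinf j).2
  have hqinj : Function.Injective qs := fun i j h ↦ by
    have := (Set.Infinite.natEmbedding S hSinf).injective (Subtype.ext h)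
    exact Fin.ext this
  have hqprime : ∀ j, (qs j).Prime := fun j ↦ (hqS j).1.1
  have hqB : ∀ j, B < qs j := fun j ↦ (hqS j).2
  set ms : Fin 5 → ℤ := fun j ↦ ε * qs j with hmsdef
  have hms0 : ∀ j, ms j ≠ 0 := fun j ↦ mul_ne_zero (by rcases hε with h | h <;> simp [h])
    (by exact_mod_cast (hqprime j).ne_zero)
  -- `mⱼ ≡ 1 (mod 8N)`
  have hms1 : ∀ j, ((8 * N : ℕ) : ℤ) ∣ ms j - 1 := fun j ↦ by
    have h1 : ((ms j : ℤ) : ZMod (8 * N)) = 1 := by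
      rw [hmsdef]
      push_cast
      rw [(hqS j).1.2, hadef, ← Int.cast_mul, hεsq, Int.cast_one]
    have h2 : ((ms j - 1 : ℤ) : ZMod (8 * N)) = 0 := by rw [Int.cast_sub, h1, Int.cast_one, sub_self]
    exact (ZMod.intCast_zmod_eq_zero_iff_dvd _ _).mp h2
  -- valuations
  have hvq : ∀ j, padicValRat (qs j) ((ms j : ℤ) : ℚ) = 1 := fun j ↦ by
    haveI : Fact (qs j).Prime := ⟨hqprime j⟩
    exact padicValRat_sign_mul_self hε
  have hvc : ∀ j, padicValRat (qs j) c = 0 := fun j ↦ by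
    haveI : Fact (qs j).Prime := ⟨hqprime j⟩
    refine padicValRat_eq_zero_of_lt hc0 ?_ ?_
    · exact lt_of_le_of_lt ((le_max_left _ _).trans (le_max_right _ _)) (hqB j)
    · exact lt_of_le_of_lt ((le_max_right _ _).trans (le_max_right _ _)) (hqB j)
  have hvqq : ∀ i j, i ≠ j → padicValRat (qs i) ((ms i * ms j : ℤ) : ℚ) = 1 := by
    intro i j hij
    haveI : Fact (qs i).Prime := ⟨hqprime i⟩
    have hne : qs i ≠ qs j := fun h ↦ hij (hqinj h)
    have h0 : ((ms j : ℤ) : ℚ) ≠ 0 := by exact_mod_cast hms0 j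
    have h0' : ((ms i : ℤ) : ℚ) ≠ 0 := by exact_mod_cast hms0 i
    have hvj : padicValRat (qs i) ((ms j : ℤ) : ℚ) = 0 := by
      haveI : Fact (qs j).Prime := ⟨hqprime j⟩
      have h1 : padicValRat (qs i) ((qs j : ℕ) : ℚ) = 0 := by
        rw [padicValRat.of_nat]
        exact_mod_cast padicValNat_primes hne
      rcases hε with h | h
      · simp [hmsdef, h, h1]
      · simp only [hmsdef, h, neg_one_mul, Int.cast_neg, Int.cast_natCast, padicValRat.neg]
        exact h1
    rw [Int.cast_mul (ms i) (ms j), padicValRat.mul h0' h0, hvj, add_zero]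
    exact hvq i
  -- (2) the five square roots in `F̄`, and a good one
  have hex : ∀ j, ∃ t : AlgebraicClosure F, t ^ 2 = ((ms j : ℤ) : AlgebraicClosure F) := fun j ↦
    IsAlgClosed.exists_pow_nat_eq _ two_pos
  choose t ht using hex
  have ht0 : ∀ j, t j ≠ 0 := fun j h ↦ by
    have := ht j
    rw [h, zero_pow two_ne_zero] at this
    exact hms0 j (by exact_mod_cast this.symm)
  have htfix : ∀ j (g : absoluteGaloisGroup F), g • (t j ^ 2) = t j ^ 2 := fun j g ↦ by
    rw [ht j, absoluteGaloisGroup.smul_def, map_intCast]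
  have htdist : ∀ i j, i ≠ j → t i * t j ∉ Set.range (algebraMap F (AlgebraicClosure F)) := by
    rintro i j hij ⟨x, hx⟩
    haveI : Fact (qs i).Prime := ⟨hqprime i⟩
    apply sq_ne_algebraMap_of_padicValRat hF2 hθ hc (hvc i) (hvqq i j hij) x
    apply (algebraMap F (AlgebraicClosure F)).injective
    rw [map_pow, hx, mul_pow, ht i, ht j, map_intCast (algebraMap ℚ F), map_intCast, Int.cast_mul (ms i) (ms j)]
  have hss : ρ.toGaloisRep.IsSemisimple := by
    haveI : Representation.IsIrreducible ρ.toGaloisRep.toRepresentation := hirr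
    change ComplementedLattice _
    infer_instance
  have hssF : (ρ.restrictField F).toGaloisRep.IsSemisimple := ρ.isSemisimple_restrictField hss
  obtain ⟨j, γ, hγt, hγtr⟩ := (ρ.restrictField F).exists_smul_eq_neg_and_trace_ne_zero hssF t ht0
    htfix htdist
  -- (3) the chosen `m = 4k + 1` with `2N ∣ k`, `q`, and `(m, N) = 1`
  set m : ℤ := ms j with hmdef
  set q : ℕ := qs j with hqdef
  haveI hqF : Fact q.Prime := ⟨hqprime j⟩
  obtain ⟨i8, hi8⟩ := hms1 j
  set k : ℤ := 2 * (N : ℤ) * i8 with hkdef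
  have hmk : m = 4 * k + 1 := by
    have h1 : m - 1 = ((8 * N : ℕ) : ℤ) * i8 := hi8
    rw [hkdef]
    push_cast at h1
    linear_combination h1
  have htj : t j ^ 2 = (m : AlgebraicClosure F) := by rw [hmdef]; exact ht j
  have hcm : 0 < c * (m : ℚ) := by
    by_cases hcpos : 0 < c
    · have hε1 : ε = 1 := by rw [hεdef, if_pos hcpos]
      have hm : (0 : ℚ) < m := by
        change (0 : ℚ) < ((ε * (qs j : ℤ) : ℤ) : ℚ)
        rw [hε1, one_mul]
        exact_mod_cast (hqprime j).pos
      exact mul_pos hcpos hm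
    · have hε1 : ε = -1 := by rw [hεdef, if_neg hcpos]
      have hcneg : c < 0 := lt_of_le_of_ne (not_lt.mp hcpos) hc0
      have hm : (m : ℚ) < 0 := by
        change ((ε * (qs j : ℤ) : ℤ) : ℚ) < 0
        rw [hε1, neg_one_mul]
        push_cast
        exact neg_neg_of_pos (by exact_mod_cast (hqprime j).pos)
      exact mul_pos_of_neg_of_neg hcneg hm
  have hgcd : Int.gcd m N = 1 := by
    have hcop : IsCoprime m (N : ℤ) := by
      refine ⟨1, -(8 * i8), ?_⟩
      have h1 : m - 1 = ((8 * N : ℕ) : ℤ) * i8 := hi8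
      push_cast at h1
      linear_combination h1
    exact Int.isCoprime_iff_gcd_eq_one.mp hcop
  have hmP : ∀ {K : Type} [Field K] [NumberField K] {u : HeightOneSpectrum (𝓞 K)},
      u.asIdeal.under (𝓞 ℚ) = v.asIdeal → ∀ (𝔓 : Ideal (absIntegers (𝓞 K) K)),
        𝔓 ∈ u.primesAbove → ((m : absIntegers (𝓞 K) K)) ∉ 𝔓 :=
    fun hu 𝔓 h𝔓 ↦ intCast_not_mem_of_gcd_eq_one hu hgcd h𝔓
  have hkP : ∀ {K : Type} [Field K] [NumberField K] {u : HeightOneSpectrum (𝓞 K)},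
      u.asIdeal.under (𝓞 ℚ) = v.asIdeal → ∀ (𝔓 : Ideal (absIntegers (𝓞 K) K)),
        𝔓 ∈ u.primesAbove → ((k : absIntegers (𝓞 K) K)) ∈ 𝔓 := by
    intro K _ _ u hu 𝔓 h𝔓
    have hN := natCast_absNorm_mem_of_mem_primesAbove hu h𝔓
    have h1 : ((k : absIntegers (𝓞 K) K)) = (2 * i8 : ℤ) * (((N : ℕ) : ℤ) : absIntegers (𝓞 K) K) := by
      rw [hkdef]; push_cast; ring
    rw [h1]
    exact 𝔓.mul_mem_left _ hN
  -- (4) the fields `F₁ = ℚ(√(c m))` and `M = F(√m)`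
  have hD : ∀ r : ℚ, r ^ 2 ≠ c * (m : ℚ) + 0 * r := fun r ↦ by
    rw [zero_mul, add_zero]
    refine Rat.sq_ne_of_padicValRat_eq_one (q := q) ?_ r
    rw [padicValRat.mul hc0 (by exact_mod_cast hms0 j), hvc j, zero_add]
    exact hvq j
  haveI : Fact (∀ r : ℚ, r ^ 2 ≠ c * (m : ℚ) + 0 * r) := ⟨hD⟩
  let F₁ : Type := QuadraticAlgebra ℚ (c * (m : ℚ)) 0
  haveI : NumberField F₁ := NumberField.mk
  have hF₁2 : Module.finrank ℚ F₁ = 2 := QuadraticAlgebra.finrank_eq_two (c * (m : ℚ)) 0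
  set θ₁ : F₁ := ⟨0, 1⟩ with hθ₁def
  have hθ₁sq : θ₁ ^ 2 = algebraMap ℚ F₁ (c * m) := quadAlg_omega_sq (c * (m : ℚ))
  have hθ₁ : θ₁ ∉ Set.range (algebraMap ℚ F₁) := quadAlg_omega_not_mem_range (c * (m : ℚ))
  have hF₁R : IsTotallyReal F₁ := isTotallyReal_of_sq_eq_of_pos hF₁2 hθ₁ hθ₁sq hcm
  have hMfact : ∀ r : F, r ^ 2 ≠ (m : F) + 0 * r := fun r ↦ by
    rw [zero_mul, add_zero]
    have h := sq_ne_algebraMap_of_padicValRat hF2 hθ hc (hvc j) (hvq j) r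
    rwa [map_intCast] at h
  haveI : Fact (∀ r : F, r ^ 2 ≠ (m : F) + 0 * r) := ⟨hMfact⟩
  let M : Type := QuadraticAlgebra F (m : F) 0
  haveI : Module.Finite ℚ M := Module.Finite.trans F M
  haveI : NumberField M := NumberField.mk
  have hFM : Module.finrank F M = 2 := QuadraticAlgebra.finrank_eq_two (m : F) 0
  set μ : M := ⟨0, 1⟩ with hμdef
  have hμsq : μ ^ 2 = (m : M) := (quadAlg_omega_sq (m : F)).trans (quadAlg_intCast_eq (m : F) m).symm
  have hμF : μ ∉ Set.range (algebraMap F M) := quadAlg_omega_not_mem_range (m : F)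
  -- `M` as an `F₁`-algebra: `√(c m) ↦ √c · √m`
  have hθθ : θ * θ = (c : F) := by rw [← sq, hc]; exact eq_ratCast _ c
  set u : M := ⟨0, θ⟩ with hudef
  have hu : u * u = (c * (m : ℚ)) • (1 : M) + (0 : ℚ) • u := by
    rw [zero_smul, add_zero, Algebra.smul_def, mul_one]
    have h1 : u * u = algebraMap F M ((m : F) * θ * θ) := quadAlg_mk_zero_mul_mk_zero (m : F) θ θ
    have h2 : (m : F) * θ * θ = algebraMap ℚ F (c * m) := by
      rw [mul_assoc, hθθ, map_mul, eq_ratCast (algebraMap ℚ F) c, map_intCast, mul_comm]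
    rw [h1, h2, ← IsScalarTower.algebraMap_apply ℚ F M]
  let φ : F₁ →ₐ[ℚ] M := QuadraticAlgebra.lift ⟨u, hu⟩
  letI : Algebra F₁ M := φ.toRingHom.toAlgebra
  haveI : IsScalarTower ℚ F₁ M := IsScalarTower.of_algebraMap_eq fun r ↦ (φ.commutes r).symm
  have hφ : ∀ z : F₁, algebraMap F₁ M z = z.re • (1 : M) + z.im • u := fun z ↦ rfl
  have hF₁M : Module.finrank F₁ M = 2 := by
    have h1 := Module.finrank_mul_finrank ℚ F₁ M
    have h2 := Module.finrank_mul_finrank ℚ F M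
    rw [hF₁2] at h1
    rw [hF2, hFM] at h2
    omega
  have hμF₁ : μ ∉ Set.range (algebraMap F₁ M) := by
    rintro ⟨z, hz⟩
    rw [hφ] at hz
    -- `(z.im : F) * θ = 1`, so `θ ∈ ℚ`
    have him : (z.im : F) * θ = 1 := by
      rw [← quadAlg_im_smul_one_add_smul_mk (m : F) z.re z.im θ]
      exact congrArg QuadraticAlgebra.im hz
    apply hθ
    refine ⟨(z.im)⁻¹, ?_⟩
    rw [map_inv₀, eq_ratCast]
    exact (eq_inv_of_mul_eq_one_right him).symm
  -- (5) the Galois side conditions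
  set e := absEmbedding ℚ F with hedef
  have he := mem_range_absGaloisRestrict_iff_smul_absEmbedding ℚ F
  set e₁ := absEmbedding ℚ F₁ with he₁def
  have he₁ := mem_range_absGaloisRestrict_iff_smul_absEmbedding ℚ F₁
  have heθ0 : e θ ≠ 0 := (map_ne_zero_iff _ e.toRingHom.injective).mpr hθ0
  have heθsq : e θ ^ 2 = (c : AlgebraicClosure ℚ) := by
    rw [← map_pow, hc, eq_ratCast (algebraMap ℚ F) c, map_ratCast]
  have he₁sq : e₁ θ₁ ^ 2 = (c : AlgebraicClosure ℚ) * (m : AlgebraicClosure ℚ) := by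
    rw [← map_pow, hθ₁sq, eq_ratCast (algebraMap ℚ F₁) (c * m), map_ratCast, Rat.cast_mul,
      Rat.cast_intCast]
  have hAc0 : (c : AlgebraicClosure ℚ) ≠ 0 := Rat.cast_ne_zero.mpr hc0
  set s : AlgebraicClosure ℚ := e₁ θ₁ * (e θ)⁻¹ with hsdef
  have hs : s ^ 2 = (m : AlgebraicClosure ℚ) := by
    rw [hsdef, mul_pow, inv_pow, heθsq, he₁sq, mul_comm (c : AlgebraicClosure ℚ),
      mul_inv_cancel_right₀ hAc0]
  have hprod : e θ * e₁ θ₁ = s * (c : AlgebraicClosure ℚ) := by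
    rw [hsdef, ← heθsq, sq, mul_assoc, inv_mul_cancel_left₀ heθ0, mul_comm]
  have hvv : v.asIdeal.under (𝓞 ℚ) = v.asIdeal := Ideal.ext fun _ ↦ Iff.rfl
  -- every element of `Γ_ℚ` fixing `s` fixes `e θ · e₁ θ₁`
  have hfixprod : ∀ g : absoluteGaloisGroup ℚ, g • s = s → g • (e θ * e₁ θ₁) = e θ * e₁ θ₁ := by
    intro g hgs
    rw [hprod, smul_mul', hgs, absoluteGaloisGroup.smul_def g (c : AlgebraicClosure ℚ), map_ratCast]
  have hI : ∀ 𝔓 ∈ v.primesAbove, 𝔓.inertia (absoluteGaloisGroup ℚ) ⊓ (absGaloisRestrict ℚ F₁).range ≤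
      (absGaloisRestrict ℚ F).range := by
    intro 𝔓 h𝔓
    haveI : 𝔓.IsPrime := h𝔓.1
    have hS : ∀ g ∈ 𝔓.inertia (absoluteGaloisGroup ℚ), g • (e θ * e₁ θ₁) = e θ * e₁ θ₁ :=
      fun g hg ↦ hfixprod g (smul_eq_self_of_mem_inertia_of_sq_eq hmk hs (hmP hvv 𝔓 h𝔓) hg)
    rw [← inf_range_absGaloisRestrict_eq_of_smul_mul_eq hF2 hθ he hF₁2 hθ₁ he₁ hS]
    exact inf_le_right
  have hD' : ∀ 𝔓 ∈ v.primesAbove, ∀ g : absoluteGaloisGroup ℚ, (∀ x ∈ 𝔓, g • x ∈ 𝔓) →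
      g ∈ (absGaloisRestrict ℚ F).range → g ∈ (absGaloisRestrict ℚ F₁).range := by
    intro 𝔓 h𝔓 g hg hgF
    haveI : 𝔓.IsPrime := h𝔓.1
    have hgs : g • s = s := smul_eq_self_of_smul_mem_of_sq_eq hmk hs (hkP hvv 𝔓 h𝔓) hg
    have hgθ : g • e θ = e θ := (mem_range_absGaloisRestrict_iff_smul_gen_eq hF2 hθ he g).mp hgF
    have h1 := hfixprod g hgs
    rw [smul_mul', hgθ] at h1
    exact (mem_range_absGaloisRestrict_iff_smul_gen_eq hF₁2 hθ₁ he₁ g).mpr (mul_left_cancel₀ heθ0 h1)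
  have hg' : ∃ g : absoluteGaloisGroup ℚ, g ∉ (absGaloisRestrict ℚ F₁).range ∧
      FramedRep.trace ρ g ≠ 0 := by
    refine ⟨absGaloisRestrict ℚ F γ, fun hmem ↦ ?_, hγtr⟩
    have h1 : absGaloisRestrict ℚ F γ • e₁ θ₁ = e₁ θ₁ := ((he₁ _).mp hmem) θ₁
    have h2 : absGaloisRestrict ℚ F γ • e θ = e θ := absGaloisRestrict_smul_absEmbedding ℚ F γ θ
    have h3 : absGaloisRestrict ℚ F γ • s = s := by rw [hsdef, smul_mul', smul_inv'', h1, h2]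
    have h4 := absGaloisRestrict_apply_smul ℚ F γ s
    rw [h3] at h4
    -- `γ` fixes the square root `ι(s)` of `m` in `F̄`, but negates `t j`
    have h5 : (absClosureEmbedding ℚ F s) ^ 2 = t j ^ 2 := by
      rw [← map_pow, hs, map_intCast, htj]
    exact absoluteGaloisGroup.smul_ne_of_smul_eq_neg (ht0 j) hγt h5 h4.symm
  have hγM : ∃ γ' : absoluteGaloisGroup F, γ' ∉ (absGaloisRestrict F M).range ∧
      FramedRep.trace (ρ.restrictField F) γ' ≠ 0 := by
    refine ⟨γ, fun hmem ↦ ?_, hγtr⟩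
    have h1 : γ • absEmbedding F M μ = absEmbedding F M μ :=
      ((mem_range_absGaloisRestrict_iff_smul_absEmbedding F M γ).mp hmem) μ
    have h5 : (absEmbedding F M μ) ^ 2 = t j ^ 2 := by
      rw [← map_pow, hμsq, map_intCast, htj]
    exact absoluteGaloisGroup.smul_ne_of_smul_eq_neg (ht0 j) hγt h5 h1
  have hwM : Algebra.IsUnramifiedIn (𝓞 M) w.asIdeal :=
    isUnramifiedIn_of_sq_eq_intCast (K := F) M hFM hμF hmk hμsq w (fun 𝔓 h𝔓 ↦ hmP rfl 𝔓 h𝔓)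
  have hsplitF : w.asIdeal.inertiaDegIn (𝓞 M) = 1 :=
    inertiaDegIn_eq_one_of_sq_eq_intCast (K := F) M hFM hμF hmk hμsq w (fun 𝔓 h𝔓 ↦ hkP rfl 𝔓 h𝔓)
  have huM : ∀ u₁ : HeightOneSpectrum (𝓞 F₁), u₁.asIdeal.under (𝓞 ℚ) = v.asIdeal →
      Algebra.IsUnramifiedIn (𝓞 M) u₁.asIdeal := fun u₁ hu₁ ↦
    isUnramifiedIn_of_sq_eq_intCast (K := F₁) M hF₁M hμF₁ hmk hμsq u₁ (fun 𝔓 h𝔓 ↦ hmP hu₁ 𝔓 h𝔓)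
  have hsplitF₁ : ∀ u₁ : HeightOneSpectrum (𝓞 F₁), u₁.asIdeal.under (𝓞 ℚ) = v.asIdeal →
      u₁.asIdeal.inertiaDegIn (𝓞 M) = 1 := fun u₁ hu₁ ↦
    inertiaDegIn_eq_one_of_sq_eq_intCast (K := F₁) M hF₁M hμF₁ hmk hμsq u₁ (fun 𝔓 h𝔓 ↦ hkP hu₁ 𝔓 h𝔓)
  -- (6) conclusion
  exact Langlands1980_quadraticBaseChange_frobCompatible_at_of_auxField' hCar hArch hBCc hACu hF2 ι π
    hT hTL hTR ρ hirr hρ P hBC w hwp hunr F₁ hF₁2 hF₁R M hFM hF₁M hI hD' huniq hfw hg' hγM hwM hsplitF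
    huM hsplitF₁

include hCar in
/-- **`Langlands1980_quadraticBaseChange_frobCompatible` from Carayol's theorem and Langlands'
base change alone.**  The named fact of `QuadraticBaseChangeFrobCompatible` follows from: Carayol's
local–global compatibility in the unramified a.e. form (C') (the inline hypothesis `hCar`:
Carayol 1986, Thm. (A) with §0.5; Taylor 1989/1990 in even degree; Skinner 2009 §1 (1)) together
with three clauses of Langlands' base change for a quadratic (cyclic of prime degree) extension as
vendored from Arthur–Clozel: the strong lifting at the archimedean places and at the finite places
unramified in the extension (`ArthurClozel1989_strongLifting_archimedean`,
`ArthurClozel1989_strongLifting_unramified`) and the existence of the cuspidal lift of a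
non-dihedral `π` (`baseChange_cyclic_cuspidal`).  No Galois representation attached to an
automorphic representation of `GL₂` over the quadratic field `F` is used (lang.S27 is not needed).
Case A (`ℓ = w ∩ ℤ` unramified in `F`) is `…_at_of_isUnramifiedIn''`; Case B (`ℓ` ramified in `F`)
is `…_at_of_not_isUnramifiedIn'`. [cite: LanglandsBaseChange1980, §2 (A), (F) (pp. 19–20) with (i) (p. 13)]
[cite: CarayolASENS1986, Thm. (A) (pp. 410–411) with §0.5]
[cite: ArthurClozelAMS120, Ch. 3 Thm. 4.2 (a), Thm. 5.1] -/
theorem Langlands1980_quadraticBaseChange_frobCompatible_of_carayol'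
    (hArch : ArthurClozel1989_strongLifting_archimedean)
    (hBCc : baseChange_cyclic_cuspidal) (hACu : ArthurClozel1989_strongLifting_unramified) :
    Langlands1980_quadraticBaseChange_frobCompatible := by
  unfold Langlands1980_quadraticBaseChange_frobCompatible
  intro F _ _ hF2 p _ ι hQ hF π T hT hTL hTR ρ hirr hρ P hBC w hwp hunr
  by_cases hram : Algebra.IsUnramifiedIn (𝓞 F) (w.under (𝓞 ℚ)).asIdeal
  · exact Langlands1980_quadraticBaseChange_frobCompatible_at_of_isUnramifiedIn'' hCar hACu hF2 ι π
      hT hTL hTR ρ hirr hρ P hBC w hwp hram hunr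
  · exact Langlands1980_quadraticBaseChange_frobCompatible_at_of_not_isUnramifiedIn' hCar hArch
      hBCc hACu hF2 ι π hT hTL hTR ρ hirr hρ P hBC w hwp hram hunr

end CaseB

end Literature.NumberTheory.Automorphic

end
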